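import Mathlib
import Summits.NavierStokesRegularity.NavierStokesRegularity.Theorems.TypeIQuarterGateScarEnvelopeTypeISatelliteTowerRigidClosure

/-!
# Satellite tower for crux `ScarEnvelopeTypeI` (stmt-NavierStokesRegularity-23843) — Part T3–T7: the exactly-critical family, the doubly-minimal enemy, THE RIGID CENSUS

Part T3–T7 of nsreg-p3's ROUND-39 artefact (section `Rigid`): T3 `ExactCrit I` (root objects of the level-critical class `M_c(I)` with `𝐈 ≤ I`),
`ExactCrit.tightRate_eq`; T4 `minLevel I`, ★★ `minLevel_attained` (second minimisation: the energy attains its minimum on the exactly-critical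
family); T5 `DoublyMin I n`, ★★★ `DoublyMin.blowup` (every tangent flow at a scar of a doubly-minimal object is again doubly-minimal: same class,
same exact scar rate, same energy), `DoublyMin.tightRate_root_eq`; T6 `LeafNode`, `RigidDescent I`, ★★★ `doublyMin_leaf_or_rigidDescent` /
`leaf_or_rigidDescent_of_not_scarEnvelopeTypeI` (THE RIGID CENSUS: if 23843 fails there is a doubly-minimal ONE-SCAR LEAF or a RIGID —
iso-energetic, iso-rated, exactly-critical — infinite descent); T7 ★★ `scarEnvelopeTypeI_of_rigid_exclusions`, `scarEnvelopeTypeI_of_noLeaf_noRigidDescent`.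

PROVENANCE: declaration texts VERBATIM from the HOME artefact of the instrument seat nsreg-p3 g27 (cell `pub/ns-regularity-ideate`):
`round-39/Rigid39.lean` (sha16 `26407934d39cc04d`, parts `partT0.lean`/`partT1.lean`; a standalone module written against the TREE;
memo `round-39/ROUND-39.md` 5db3c59e41d183b7), scored PASS ★★ by referee ref3 g27 (`SCORE-p3-ROUND-39-0828.md` 653f7ae86a8d9398); the author cannot write under `Theorems/`
(`perm.theorems-prover-only`); landed by the prover ns-es-p1 g5 as landing hand of record (director-ns DIRECTOR-NS #237 (3)), split into
≤ 400-line modules, `E3` spelled out, the artefact's `#guard_msgs … #print axioms` certificates not landed.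
`--supports stmt-NavierStokesRegularity-23843 --as helper`.

HONEST FRAMING: instrument theorems about HYPOTHETICAL Type-I zoom limits (Albritton–Barker objects of the census of crux
`TypeIQuarterGate.ScarEnvelopeTypeI`, item 23843); the analytic input is the tree's closure engine (compactness
`local_typeI_compactness_twin_inBall`, sharpened to constant 1 in Part S1; Q1 whole-space), P1 rate inheritance, L8 persistence and the
tree's PROVED small-constant Liouville theorem; Parts R/S are order theory on the re-classing and closure lemmas.  NOTHING OPEN IS
PROVED: 23843, (L′) `TypeILiouvilleAB` / (L′₀), the GLOBAL (S∞) = `CritAttained`, (M𝐈₁), (E1⁺), (E2ᵣ), route ExtremalTypeIConstant's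
cruxes, N0 and Navier–Stokes regularity are OPEN; `critRate`, `levelCrit I`, `liouvilleRate` are `sInf`s that are `0` by junk value
when the defining set is empty (every statement using them carries the nonemptiness hypothesis explicitly).
-/

-- the summit-side namespace repeats a component by design (single-conjunct summit, D-0017)
set_option linter.dupNamespace false

open MeasureTheory Set Metric Filter Topology
open scoped ENNReal NNReal InnerProductSpace
open Literature.Analysis.FluidPDE

namespace Summit.NavierStokesRegularity.NavierStokesRegularity.Cruxes.ScarEnvelopeTypeI.ZoomDictionary

section Rigid

variable {U : ℝ → (EuclideanSpace ℝ (Fin 3)) → (EuclideanSpace ℝ (Fin 3))} {P : ℝ → (EuclideanSpace ℝ (Fin 3)) → ℝ}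

/-! ### T3. The exactly-critical family of a finite energy level -/

/-- The **EXACTLY-CRITICAL FAMILY** of the energy level `I`: ROOT objects of the level-critical class
`M_c(I)` with `𝐈 ≤ I`.  By S5 it is nonempty as soon as the level carries a scar, and (T3b) EVERY scar
of EVERY member is tight-rated EXACTLY `M_c(I)`. -/
def ExactCrit (I : ℝ≥0∞) (n : TNode) : Prop := RootObj (levelCrit I) n ∧ n.level ≤ I

/-- The exactly-critical family of a finite scar-carrying energy level is nonempty (S5). -/
theorem exactCrit_nonempty {I : ℝ≥0∞} (hI : I < ⊤) (hne : (levelRates I).Nonempty) :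
    ∃ n : TNode, ExactCrit I n :=
  levelCrit_attained hI hne

/-- A member of `ExactCrit I` witnesses that level `I` carries a scar. -/
theorem ExactCrit.levelRates_nonempty {I : ℝ≥0∞} {n : TNode} (h : ExactCrit I n) :
    (levelRates I).Nonempty :=
  ⟨_, _, n, 0, h.1.1, h.2, h.1.2, rfl⟩

/-- T3b. EXACTNESS is a property of the whole family (not only of the S5 representative). -/
theorem ExactCrit.tightRate_eq {I : ℝ≥0∞} {n : TNode} (h : ExactCrit I n) {y : (EuclideanSpace ℝ (Fin 3))}
    (hy : ¬ RegPt n.U y) : tightRate n.U y = levelCrit I :=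
  le_antisymm ((towerObj_of_abTower h.1.1).tightRate_le y) (levelCrit_le ⟨_, n, y, h.1.1, h.2, hy, rfl⟩)

/-- T3c. The family does not see the chosen point of the node. -/
theorem ExactCrit.repoint {I : ℝ≥0∞} {n : TNode} (h : ExactCrit I n) (y₁ : (EuclideanSpace ℝ (Fin 3))) :
    ExactCrit I ⟨n.U, n.P, n.H, y₁⟩ :=
  h

/-! ### T4. The minimal energy of the exactly-critical family is ATTAINED -/

/-- The **MINIMAL ENERGY** of the exactly-critical family of the level `I`. -/
noncomputable def minLevel (I : ℝ≥0∞) : ℝ≥0∞ := sInf (TNode.level '' {n | ExactCrit I n})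

/-- `minLevel I ≤ n.level` for every member `n` of the exactly-critical family. -/
theorem minLevel_le {I : ℝ≥0∞} {n : TNode} (h : ExactCrit I n) : minLevel I ≤ n.level :=
  sInf_le ⟨n, h, rfl⟩

/-- `minLevel I ≤ I` whenever the finite level `I` carries a scar. -/
theorem minLevel_le_self {I : ℝ≥0∞} (hI : I < ⊤) (hne : (levelRates I).Nonempty) : minLevel I ≤ I := by
  obtain ⟨n, hn⟩ := exactCrit_nonempty hI hne
  exact (minLevel_le hn).trans hn.2

/-- ★★ **T4. THE SECOND MINIMISATION.**  At every finite energy level carrying a scar the energy `𝐈`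
ATTAINS ITS MINIMUM on the exactly-critical family: a minimising sequence has constant class `M_c(I)`,
levels `≤ I`, singular roots; its T1-limit is a member whose level is below every eventual bound of the
levels, i.e. `≤ minLevel I`. -/
theorem minLevel_attained {I : ℝ≥0∞} (hI : I < ⊤) (hne : (levelRates I).Nonempty) :
    ∃ n : TNode, ExactCrit I n ∧ n.level = minLevel I := by
  set S : Set ℝ≥0∞ := TNode.level '' {n | ExactCrit I n} with hS
  have hSne : S.Nonempty := by
    obtain ⟨n, hn⟩ := exactCrit_nonempty hI hne
    exact ⟨_, n, hn, rfl⟩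
  obtain ⟨u, -, hu, huS⟩ := exists_seq_tendsto_sInf hSne (OrderBot.bddBelow S)
  have hn : ∀ k, ∃ n : TNode, ExactCrit I n ∧ n.level = u k := fun k => by
    obtain ⟨n, hn, hnk⟩ := huS k
    exact ⟨n, hn, hnk⟩
  choose n hnE hnu using hn
  obtain ⟨U', P', H', σ, -, hT', hI', hlim, -, -, hpers⟩ :=
    abSeq_closed' hI (fun k => (n k).U) (fun k => (n k).P) (fun k => (n k).H)
      (fun k => (hnE k).1.1) (fun k => (hnE k).2) (tendsto_const_nhds (x := levelCrit I))
  set n' : TNode := ⟨U', P', H', 0⟩ with hn'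
  have hE' : ExactCrit I n' := ⟨⟨hT', hpers fun k => (hnE k).1.2⟩, hI'⟩
  refine ⟨n', hE', le_antisymm ?_ (minLevel_le hE')⟩
  -- `𝐈(n') ≤ b` for every `b > minLevel I`: the levels `u k` are eventually `≤ b`
  refine le_of_forall_gt_imp_ge_of_dense fun b hb => hlim b ?_
  have hev : ∀ᶠ k in atTop, u k < b := hu.eventually (gt_mem_nhds hb)
  exact hev.mono fun k hk => by
    show typeIBound (Iio (0 : ℝ) ×ˢ univ) (n k).U (n k).P (n k).H ≤ b
    exact ((hnu k).trans_lt hk |>.le : (n k).level ≤ b)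

/-! ### T5. Doubly-minimal objects: energy and rate are CONSERVED under blow-up -/

/-- A **DOUBLY-MINIMAL** object of the level `I`: exactly critical (class `M_c(I)`, every scar exactly
`M_c(I)`-rated, `𝐈 ≤ I`) AND of minimal energy `𝐈 = minLevel I` among such.  EXISTS at every finite
level carrying a scar (T4). -/
def DoublyMin (I : ℝ≥0∞) (n : TNode) : Prop := ExactCrit I n ∧ n.level = minLevel I

/-- The doubly-minimal family of a finite scar-carrying energy level is nonempty (T4). -/
theorem doublyMin_nonempty {I : ℝ≥0∞} (hI : I < ⊤) (hne : (levelRates I).Nonempty) :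
    ∃ n : TNode, DoublyMin I n :=
  minLevel_attained hI hne

/-- Re-pointing a doubly-minimal object at another of its scars keeps it doubly-minimal. -/
theorem DoublyMin.repoint {I : ℝ≥0∞} {n : TNode} (h : DoublyMin I n) (y₁ : (EuclideanSpace ℝ (Fin 3))) :
    DoublyMin I ⟨n.U, n.P, n.H, y₁⟩ :=
  h

/-- ★★ **T5a.** Blow-up inside the exactly-critical family: every tangent flow at a scar of a member is
(a.e. on the unit window) a member of the SAME family with `𝐈` not larger. -/
theorem ExactCrit.blowup {I : ℝ≥0∞} {n : TNode} (h : ExactCrit I n) {y : (EuclideanSpace ℝ (Fin 3))} (hy : ¬ RegPt n.U y)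
    {L : ℕ → ℝ} {Ū : ℝ → (EuclideanSpace ℝ (Fin 3)) → (EuclideanSpace ℝ (Fin 3))} (hŪ : TangentU n.U n.P y 0 L Ū) (y₁ : (EuclideanSpace ℝ (Fin 3))) :
    ∃ n' : TNode, ExactCrit I n' ∧ n'.level ≤ n.level ∧ n'.y = y₁ ∧
      ∀ R ∈ Ioo (0 : ℝ) 1,
        ∀ᵐ z ∂(volume.restrict (parabolicCylinder R (0 : ℝ × (EuclideanSpace ℝ (Fin 3))))), Ū z.1 z.2 = n'.U z.1 z.2 := by
  obtain ⟨U', P', H', hT', hI', hid, hpers⟩ := h.1.1.reclass_tangent hŪ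
  rw [h.tightRate_eq hy] at hT'
  exact ⟨⟨U', P', H', y₁⟩, ⟨⟨hT', hpers hy⟩, hI'.trans h.2⟩, hI', rfl, hid⟩

/-- ★★★ **T5b. NOTHING IS LOST IN THE BLOW-UP OF A DOUBLY-MINIMAL OBJECT.**  At EVERY scar `y` of a
doubly-minimal object `n`, EVERY tangent flow is (a.e. on the unit window) a DOUBLY-MINIMAL object `n'`
of the SAME level: same class `M_c(I)`, every scar again EXACTLY `M_c(I)`-rated, singular root, and THE
SAME ENERGY `𝐈(n') = 𝐈(n)` — the renormalisation map «zoom in at a scar and pass to the limit»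
preserves BOTH monotone functionals (the class/rate, Part R/S, and the energy, Part S3) EXACTLY. -/
theorem DoublyMin.blowup {I : ℝ≥0∞} {n : TNode} (h : DoublyMin I n) {y : (EuclideanSpace ℝ (Fin 3))} (hy : ¬ RegPt n.U y)
    {L : ℕ → ℝ} {Ū : ℝ → (EuclideanSpace ℝ (Fin 3)) → (EuclideanSpace ℝ (Fin 3))} (hŪ : TangentU n.U n.P y 0 L Ū) (y₁ : (EuclideanSpace ℝ (Fin 3))) :
    ∃ n' : TNode, DoublyMin I n' ∧ n'.level = n.level ∧ n'.y = y₁ ∧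
      (∀ R ∈ Ioo (0 : ℝ) 1,
        ∀ᵐ z ∂(volume.restrict (parabolicCylinder R (0 : ℝ × (EuclideanSpace ℝ (Fin 3))))), Ū z.1 z.2 = n'.U z.1 z.2) ∧
      (∀ y' : (EuclideanSpace ℝ (Fin 3)), ¬ RegPt n'.U y' → tightRate n'.U y' = levelCrit I) := by
  obtain ⟨n', hE', hle, hy₁, hid⟩ := h.1.blowup hy hŪ y₁
  have heq : n'.level = n.level := le_antisymm hle (h.2 ▸ minLevel_le hE')
  exact ⟨n', ⟨hE', heq.trans h.2⟩, heq, hy₁, hid, fun y' hy' => hE'.tightRate_eq hy'⟩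

/-- T5c. The scar rates are conserved too: the root of the blow-up is rated exactly as the scar zoomed at. -/
theorem DoublyMin.tightRate_root_eq {I : ℝ≥0∞} {n n' : TNode} (h : DoublyMin I n) (h' : DoublyMin I n')
    {y : (EuclideanSpace ℝ (Fin 3))} (hy : ¬ RegPt n.U y) : tightRate n'.U 0 = tightRate n.U y := by
  rw [h.1.tightRate_eq hy, h'.1.tightRate_eq h'.1.1.2]

/-! ### T6. THE RIGID CENSUS: a doubly-minimal one-scar leaf, or a rigid infinite descent -/

/-- A **ONE-SCAR node**: no satellite in the punctured open unit ball of the final-time slice. -/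
def LeafNode (n : TNode) : Prop := ∀ y : (EuclideanSpace ℝ (Fin 3)), y ≠ 0 → ‖y‖ < 1 → RegPt n.U y

/-- A **RIGID DESCENT** at the level `I`: an infinite chain of DOUBLY-MINIMAL nodes, the chosen point of
each a satellite, each DESCENDING (tree currency `Descends`: the next field is a.e. a tangent flow at the
chosen satellite) to the next, WITH CONSTANT ENERGY (and, automatically, constant class `M_c(I)` and all
scars exactly `M_c(I)`-rated). -/
def RigidDescent (I : ℝ≥0∞) : Prop :=
  ∃ c : ℕ → TNode, ∀ k, DoublyMin I (c k) ∧ (c k).y ∈ satellites (c k).U ∧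
    Descends (c k) (c (k + 1)) ∧ (c (k + 1)).level = (c k).level

/-- An exactly-critical LEAF node is a `OneScarLeaf` of its class. -/
theorem LeafNode.oneScarLeaf {I : ℝ≥0∞} {n : TNode} (hl : LeafNode n) (h : ExactCrit I n) :
    OneScarLeaf (levelCrit I) :=
  ⟨n.U, n.P, n.H, h.1.1, h.1.2, hl⟩

/-- A rigid descent of level `I` unfolds into a chain of ROOTED nodes of the level-critical class `M_c(I)`, each descending to the next, iso-energetic at `minLevel I`, with every scar tight-rated exactly `M_c(I)`. -/
theorem RigidDescent.rootedNode {I : ℝ≥0∞} (h : RigidDescent I) :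
    ∃ c : ℕ → TNode, ∀ k, RootedNode (levelCrit I) (c k) ∧ Descends (c k) (c (k + 1)) ∧
      (c (k + 1)).level = (c k).level ∧ (c k).level = minLevel I ∧
      ∀ y : (EuclideanSpace ℝ (Fin 3)), ¬ RegPt (c k).U y → tightRate (c k).U y = levelCrit I := by
  obtain ⟨c, hc⟩ := h
  exact ⟨c, fun k => ⟨⟨⟨(hc k).1.1.1.1, (hc k).2.1⟩, (hc k).1.1.1.2⟩, (hc k).2.2.1, (hc k).2.2.2,
    (hc k).1.2, fun y hy => (hc k).1.1.tightRate_eq hy⟩⟩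

/-- ★★★ **T6. THE RIGID CENSUS OF A LEVEL.**  At every finite energy level carrying a scar: EITHER some
doubly-minimal object is a ONE-SCAR LEAF, OR there is a RIGID infinite descent (every doubly-minimal
object has a satellite in the unit ball; blowing up there conserves class, exact rates and energy, T5b,
and lands on a doubly-minimal object again — iterate by dependent choice). -/
theorem doublyMin_leaf_or_rigidDescent {I : ℝ≥0∞} (hI : I < ⊤) (hne : (levelRates I).Nonempty) :
    (∃ n : TNode, DoublyMin I n ∧ LeafNode n) ∨ RigidDescent I := by
  by_cases hleaf : ∃ n : TNode, DoublyMin I n ∧ LeafNode n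
  · exact Or.inl hleaf
  right
  have hsat : ∀ n : TNode, DoublyMin I n → ∃ y : (EuclideanSpace ℝ (Fin 3)), y ∈ satellites n.U ∧ ‖y‖ < 1 := by
    intro n hn
    by_contra hno
    simp only [not_exists, not_and, not_lt] at hno
    exact hleaf ⟨n, hn, fun y hy0 hy1 => by_contra fun hreg => (not_le.2 hy1) (hno y ⟨hy0, hreg⟩)⟩
  -- the successor of a doubly-minimal node whose point is a satellite
  have hstep : ∀ d : {n : TNode // DoublyMin I n ∧ n.y ∈ satellites n.U},
      ∃ d' : {n : TNode // DoublyMin I n ∧ n.y ∈ satellites n.U},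
        Descends d.1 d'.1 ∧ d'.1.level = d.1.level := by
    rintro ⟨n, hn, hy⟩
    obtain ⟨L, Ū, hŪ⟩ := exists_tangentU_of_towerObj (towerObj_of_abTower hn.1.1.1) n.y
    obtain ⟨n₁, hn₁, hlev, -, hid, -⟩ := hn.blowup hy.2 hŪ 0
    obtain ⟨y₁, hy₁, hy₁1⟩ := hsat n₁ hn₁
    exact ⟨⟨⟨n₁.U, n₁.P, n₁.H, y₁⟩, hn₁.repoint y₁, hy₁⟩, ⟨L, Ū, hŪ, hid, hy₁1⟩, hlev⟩
  choose next hnext using hstep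
  obtain ⟨n₀, hn₀⟩ := doublyMin_nonempty hI hne
  obtain ⟨y₀, hy₀, -⟩ := hsat n₀ hn₀
  let d₀ : {n : TNode // DoublyMin I n ∧ n.y ∈ satellites n.U} :=
    ⟨⟨n₀.U, n₀.P, n₀.H, y₀⟩, hn₀.repoint y₀, hy₀⟩
  let f : ℕ → {n : TNode // DoublyMin I n ∧ n.y ∈ satellites n.U} :=
    fun k => Nat.rec d₀ (fun _ d => next d) k
  have hf : ∀ k, f (k + 1) = next (f k) := fun k => rfl
  refine ⟨fun k => (f k).1, fun k => ⟨(f k).2.1, (f k).2.2, ?_, ?_⟩⟩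
  · show Descends (f k).1 (f (k + 1)).1
    rw [hf]; exact (hnext (f k)).1
  · show (f (k + 1)).1.level = (f k).1.level
    rw [hf]; exact (hnext (f k)).2

/-- ★★★ **T6b. THE RIGID NORMAL FORM OF THE ENEMY OF 23843.**  If `ScarEnvelopeTypeI` fails then at the
finite energy level `I₀` of the violating tower (`M_c(I₀) ∈ [ε_L, M]`) there is a DOUBLY-MINIMAL ONE-SCAR
LEAF (class `M_c(I₀)`, root scar exactly `M_c(I₀)`-rated, minimal energy, no satellite in the unit ball)
OR a RIGID INFINITE DESCENT (doubly-minimal nodes, constant energy, constant class, all scars exactly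
`M_c(I₀)`-rated, each a.e. a tangent flow of the previous one at a satellite). -/
theorem leaf_or_rigidDescent_of_not_scarEnvelopeTypeI
    (h : ¬ Summit.NavierStokesRegularity.NavierStokesRegularity.Theses.TypeIQuarterGate.ScarEnvelopeTypeI) :
    ∃ (M : ℝ) (I₀ : ℝ≥0∞), I₀ < ⊤ ∧ (levelRates I₀).Nonempty ∧ levelCrit I₀ ∈ Icc epsL M ∧
      minLevel I₀ ≤ I₀ ∧ ((∃ n : TNode, DoublyMin I₀ n ∧ LeafNode n) ∨ RigidDescent I₀) := by
  obtain ⟨M, I₀, hI₀, hne, hIcc, -, -⟩ := exactCritical_of_not_scarEnvelopeTypeI h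
  exact ⟨M, I₀, hI₀, hne, hIcc, minLevel_le_self hI₀ hne, doublyMin_leaf_or_rigidDescent hI₀ hne⟩

/-- ★★ **T7. THE SHARPENED CENSUS.**  23843 follows from the two RIGID exclusions alone: no finite energy
level has a doubly-minimal one-scar leaf, and no finite energy level has a rigid infinite descent —
strictly fewer objects to exclude than in Parts N/O (`scarEnvelopeTypeI_of_exclusions`: every one-scar
leaf of every class and every non-tame rooted infinite descent of every class). -/
theorem scarEnvelopeTypeI_of_rigid_exclusions
    (hF : ∀ I : ℝ≥0∞, I < ⊤ → ∀ n : TNode, DoublyMin I n → ¬ LeafNode n)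
    (hD : ∀ I : ℝ≥0∞, I < ⊤ → ¬ RigidDescent I) :
    Summit.NavierStokesRegularity.NavierStokesRegularity.Theses.TypeIQuarterGate.ScarEnvelopeTypeI := by
  by_contra h
  obtain ⟨M, I₀, hI₀, -, -, -, hcases⟩ := leaf_or_rigidDescent_of_not_scarEnvelopeTypeI h
  rcases hcases with ⟨n, hn, hl⟩ | hd
  · exact hF I₀ hI₀ n hn hl
  · exact hD I₀ hI₀ hd

/-- T7b. In particular (the leaf half in the tree's currency): excluding one-scar leaves of every class
`≥ ε_L` and rigid descents of every finite level gives 23843. -/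
theorem scarEnvelopeTypeI_of_noLeaf_noRigidDescent
    (hF : ∀ M : ℝ, epsL ≤ M → ¬ OneScarLeaf M)
    (hD : ∀ I : ℝ≥0∞, I < ⊤ → ¬ RigidDescent I) :
    Summit.NavierStokesRegularity.NavierStokesRegularity.Theses.TypeIQuarterGate.ScarEnvelopeTypeI := by
  by_contra h
  obtain ⟨M, I₀, hI₀, hne, hIcc, -, hcases⟩ := leaf_or_rigidDescent_of_not_scarEnvelopeTypeI h
  rcases hcases with ⟨n, hn, hl⟩ | hd
  · exact hF _ hIcc.1 (hl.oneScarLeaf hn.1)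
  · exact hD I₀ hI₀ hd

end Rigid

end Summit.NavierStokesRegularity.NavierStokesRegularity.Cruxes.ScarEnvelopeTypeI.ZoomDictionary
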